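import Summits.QuantumFields.BalabanUV.Beta.GAN24.RespWordsLevelZero
import Summits.QuantumFields.BalabanUV.Beta.GAN24.CombChargeAntisymPairForm
import Summits.QuantumFields.BalabanUV.Beta.GAN24.CombesThomas

/-!
# `BalabanUV.Beta.GAN24.ForcingCellPairFormLevelZero` — binder row G-an2-4 ∕ (CONV-C), W-slot (α-0), ROW (C)sym AT LEVELS `≥ 1` (the OWNER's two-index
# tower, RULING R-gan24p1-g40-1; typer's PART VI row T6-STEP, SUPPLIER statement `hB0`): **THE LEG-AND-BOND SYMMETRISED CELL CHARGE OF THE LEVEL-`0` E-FRAME FORCING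
# IS AN ANTISYMMETRIC-PAIR FORM** — road-P2 g50's hypothesis `hB0` of `CombChargeTowerClosure.pairFormLS_member_and_faceReads_of_forcingPairForms` AT LEVEL `i = 0`, in its
# literal (G-an2-4 CRUX TEAM (2), leaf prover `b2b-balaban-gan24-formalise-leaf-06`, the (γ) hand, gen 55; journal [GAN24LEAF06-G55-INTENT1])

NOT IN PRINT; OUR BOOKKEEPING ([folklore] one `rw` with leaf-04's `RespWordsLevelZero.zmode_dressedSource_level0_an1_closed` (the ff zero mode of the dressed level-`0` source in CLOSED
FORM: the two `S^E ⊗ S^E` numbers `E + E′`, the second-response words cancelled) and finite index algebra in road-P2 F9's spelling (`CombChargeAntisymPairForm.pairFormLS_of_pairForm`);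
0 `def`, 0 cited fact, 0 `def … : Prop`, 0 sorry).  HONEST FRAMING (cell contract, verbatim): «discharging `BetaPertH` makes Bałaban's UV stability UNCONDITIONAL — a real
constructive-QFT result; it is NOT the continuum limit and NOT the Clay problem.»  HONEST DEPENDENCY (verbatim): «continuum YM on T⁴ ⇐ BetaPertH ∧ nine spine estimates (0/9 proved);
BetaPertH ⇐ (D1) ∧ (D4) ∧ CAP+tail; G-an2-4 gates asym, D1 and NE2/3/4.»

WHY.  After road-P2 g50's instantiation of the OWNER's tower (`CombChargeTowerStepZero` ✓, `CombChargeTowerClosure` staged) the even-class half of road FP's D1 literal on the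
G-an2-4 side costs, per level `i`, the SUPPLIER statement `hB0 i`: «`LS(zmode_Lc b̃_i)(κκ′; inl κ₁, inl κ₂)` is a pair form», `b̃_i = (cE₂·Lc^{2(d+1)}) • mmRead Lc (K3OfK X̃♮_i Lc S̃♮_i M̃_i W̃_i)
+ cB • B` the E-frame forcing (`T2RecChargeStep.zmode_succ_eq`'s letters), «`LS_A`» `:= A κκ′κ₁κ₂ + A κ′κκ₁κ₂ + (A κκ′κ₂κ₁ + A κ′κκ₂κ₁)`, «pair form» `:= ∃ T` antisymmetric in each index
pair with `LS_A = T κκ₁κ′κ₂ + T κ′κ₁κκ₂ + (T κκ₂κ′κ₁ + T κ′κ₂κκ₁)`.  AT LEVEL `0` leaf-04's closed form reads, for every axis pattern,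
`zmode Lc b̃_0 (μ,ν; inl α, inl β) = C₀·(E(μν;αβ) + E(νμ;αβ))`, `E(μν;αβ) = [μ=ν ∧ α=β] − [μ=β ∧ α=ν]`, ONE scalar `C₀` (units, `Lc`, `cE`, `c`) — and `E(μν;αβ) = P(μα;νβ)` for the
entrywise antisymmetric `P(ab;ce) := [a=c][b=e] − [a=e][b=c]`, so `zmode Lc b̃_0` is F9's ENTRYWISE pair form `C₀·(P(κκ₁;κ′κ₂) + P(κ′κ₁;κκ₂))` and its `LS` is the pair form with
`T = 2·C₀·P`.  Levels `i ≥ 1` are a different word (leaf-04 g69∕g70's 33_j `DressedSourceZeroModeSucc` ∘ this lineage's J2 `ExchangeESectorLatticeWords`, both staged) — NOT here.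

WHAT ([folklore]; in-block root `ρ = toSite r`, `1 ≤ Lc`; every unit pair `s_f s_m`, all colour constants `cE cVH cΛ`, scalars `c cB`, ANY border `B` without ff block):
* §1 **`zmode_forcing_level0_eq_pairForm`** (generic `d`): `zmode Lc b̃_0 (κ,κ′; inl κ₁, inl κ₂) = C₀·P(κκ₁;κ′κ₂) + C₀·P(κ′κ₁;κκ₂)` with the explicit product-of-indicators `P`;
* §2 **`pairFormLS_forcing_level0`** (generic `d`): `∃ T antisym², ∀ κ κ′ κ₁ κ₂, LS(zmode Lc b̃_0)(κκ′; inl κ₁, inl κ₂) = T κκ₁κ′κ₂ + T κ′κ₁κκ₂ + (T κκ₂κ′κ₁ + T κ′κ₂κκ₁)`;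
* §3 **`pairFormLS_forcing_level0_lit`**: the same at `d = 3` in road-P2's letters VERBATIM (`s_f = sfStep Lc 0`, `s_m = smStep 3 Lc 0`, `c = cE₂ * Lc^(2*(3+1))`, border `vh₂S`) =
  `CombChargeTowerClosure`'s binder `hB0` at `i = 0`, nothing renamed.
* §4 **`crossed_zmode_forcing_level0`** (generic `d`): the crossed orbit sum `X(zmode_Lc b̃_0)(a,b) = −4·C₀` for `a ≠ b` (row T6-VAL's level-`0` cell summand, leaf-03 g71's
  currency); **`crossed_zmode_forcing_level0_pin`**: `= −2·Lc¹²·(Lc² − 1)` at `d = 3` and the END probe's pins `cE = Lc^4`, `cE₂ = Lc^8`.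
Asserts NO value of Bałaban's tables beyond an3's ∕ an1's DEFINED ones (the closed form is leaf-04's theorem); discharges `hB0` AT LEVEL `0` ONLY and VALUES one crossed number — NOTHING of `hB0 (i ≥ 1)` ∕ `hBF` ∕ `hX` ∕
`hstep` ∕ `hSrc` ∕ `hSrcX` ∕ (C)_{≥1} ∕ (Q-L) ∕ (hW, hWall); NEVER «G-an2-4 closed» as (CONV-C); NOT D1, NOT `BetaPertH`, NOT continuum, NOT Clay.  2026-08-24; no existing file touched.
-/

noncomputable section

open Finset
open scoped BigOperators
open Literature.MathematicalPhysics.QuantumFieldTheory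
open Literature.MathematicalPhysics.QuantumFieldTheory.Balaban1983to89
open Literature.MathematicalPhysics.QuantumFieldTheory.Balaban1983to89.Beta
open AffineAveraging (Site box toSite)
open OneStepKernelFamily (KInvStep)
open SecondOrderResponse (W2SymOfK)
open BalabanStepW2 (K3OfK M2Of)
open BalabanStepJetsSucc (mmRead)
open AveragingMixedJetTables (mixFFAt)
open Summit.QuantumFields.BalabanUV.Beta.HessKerDressedUnits (unitK unitS)
open Summit.QuantumFields.BalabanUV.Beta.SecondOrderUnits (unitM unitM₂)
open Summit.QuantumFields.BalabanUV.Beta.AxialDressingRooted (coDressKBmAt)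
open Summit.QuantumFields.BalabanUV.Beta.SpineRooted (SpureRecAt M1At)
open Summit.QuantumFields.BalabanUV.Beta.GAN24.BiStencilZeroMode (Tab zmode)
open Summit.QuantumFields.BalabanUV.Beta.GAN24.CombesThomas (sfStep smStep)
open Summit.QuantumFields.BalabanUV.Beta.GAN24.RespWordsLevelZero (zmode_dressedSource_level0_an1_closed)
open Summit.QuantumFields.BalabanUV.Beta.GAN24.CombChargeAntisymPairForm (pairFormLS_of_pairForm)

namespace Summit.QuantumFields.BalabanUV.Beta.GAN24.ForcingCellPairFormLevelZero

variable {d : ℕ} {Lc : ℕ} [NeZero Lc] {r : Fin (d + 1) → ℕ}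

/-! ## §1 The ff zero mode of the level-`0` forcing is an entrywise antisymmetric-pair form -/

/-- NOT IN PRINT; OUR BOOKKEEPING.  **THE ff CELL ZERO MODE OF THE LEVEL-`0` E-FRAME FORCING IS F9's ENTRYWISE PAIR FORM** (in-block root, `1 ≤ Lc`, every unit pair, all colour
constants, scalars `c cB`, ANY border `B` without ff block; every axis pattern `(κ,κ′;κ₁,κ₂)`): with the scalar `C₀` of leaf-04's closed form and
`P(a b; c e) := [a=c]·[b=e] − [a=e]·[b=c]`,  `zmode Lc b̃_0 (κ,κ′; inl κ₁, inl κ₂) = C₀·P(κκ₁;κ′κ₂) + C₀·P(κ′κ₁;κκ₂)`. -/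
theorem zmode_forcing_level0_eq_pairForm (hLc : 1 ≤ Lc) (hr : r ∈ box (d + 1) Lc) (sf sm cE cVH cΛ : ℝ)
    {B : Tab d} (hBff : ∀ κ u κ' u' x z (α β : Fin (d + 1)), B κ u κ' u' x z (Sum.inl α) (Sum.inl β) = 0) (c cB : ℝ)
    (κ κ' κ₁ κ₂ : Fin (d + 1)) :
    zmode Lc (fun κ u κ' u' => c • mmRead Lc (K3OfK (unitK sf sm (coDressKBmAt (toSite r) Lc (KInvStep (d := d) Lc 0))) Lc
        (unitS sf sm (SpureRecAt d Lc (toSite r) cE cVH cΛ 0)) (unitM sf sm (M1At d Lc (toSite r) cΛ 0))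
        (W2SymOfK (unitK sf sm (coDressKBmAt (toSite r) Lc (KInvStep (d := d) Lc 0))) Lc (unitS sf sm (SpureRecAt d Lc (toSite r) cE cVH cΛ 0))
          (unitM sf sm (M1At d Lc (toSite r) cΛ 0)) 0 (unitM₂ sf sm (M2Of d Lc (mixFFAt (toSite r) Lc) 0))) κ u κ' u')
        + cB • B κ u κ' u') κ κ' (Sum.inl κ₁) (Sum.inl κ₂) =
      (c * (-((sf * sm * ((((Lc ^ (0 + 1) : ℕ) : ℝ)) ^ (d + 1 + 1))⁻¹) * (sf * sm * ((((Lc ^ (0 + 1) : ℕ) : ℝ)) ^ (d + 1 + 1))⁻¹)) * ((Lc : ℝ) * (Lc : ℝ))) *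
        (-(((((Lc : ℝ) * (sm * sf)) * ((((Lc ^ (0 + 1) : ℕ) : ℝ)) ^ (d + 1 + 1))⁻¹) * ((sf * sm)⁻¹ * (sf⁻¹ * sf⁻¹) * cE))) ^ 2 * (sf * sf) *
          ((1 / 2 : ℝ) * (Lc : ℝ) ^ (d - 1) * ((Lc : ℝ) ^ (d + 1) - (Lc : ℝ) ^ (d - 1))))) *
        ((if κ = κ' then (1 : ℝ) else 0) * (if κ₁ = κ₂ then (1 : ℝ) else 0) - (if κ = κ₂ then (1 : ℝ) else 0) * (if κ₁ = κ' then (1 : ℝ) else 0)) +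
      (c * (-((sf * sm * ((((Lc ^ (0 + 1) : ℕ) : ℝ)) ^ (d + 1 + 1))⁻¹) * (sf * sm * ((((Lc ^ (0 + 1) : ℕ) : ℝ)) ^ (d + 1 + 1))⁻¹)) * ((Lc : ℝ) * (Lc : ℝ))) *
        (-(((((Lc : ℝ) * (sm * sf)) * ((((Lc ^ (0 + 1) : ℕ) : ℝ)) ^ (d + 1 + 1))⁻¹) * ((sf * sm)⁻¹ * (sf⁻¹ * sf⁻¹) * cE))) ^ 2 * (sf * sf) *
          ((1 / 2 : ℝ) * (Lc : ℝ) ^ (d - 1) * ((Lc : ℝ) ^ (d + 1) - (Lc : ℝ) ^ (d - 1))))) *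
        ((if κ' = κ then (1 : ℝ) else 0) * (if κ₁ = κ₂ then (1 : ℝ) else 0) - (if κ' = κ₂ then (1 : ℝ) else 0) * (if κ₁ = κ then (1 : ℝ) else 0)) := by
  have hsplit : ∀ (P Q : Prop) [Decidable P] [Decidable Q],
      (if P ∧ Q then (1 : ℝ) else 0) = (if P then (1 : ℝ) else 0) * (if Q then (1 : ℝ) else 0) := by
    intro P Q _ _
    rw [ite_zero_mul_ite_zero, one_mul]
  rw [zmode_dressedSource_level0_an1_closed hLc hr sf sm cE cVH cΛ hBff c cB κ κ' κ₁ κ₂]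
  rw [hsplit, hsplit, hsplit, hsplit]
  ring

/-! ## §2 Hence its leg-and-bond symmetrised cell charge is a pair form (`hB0` at level `0`, generic `d`) -/

/-- NOT IN PRINT; OUR BOOKKEEPING.  **`hB0` AT LEVEL `0`** (generic `d`; in-block root, `1 ≤ Lc`, every unit pair `s_f s_m`, all colour constants `cE cVH cΛ`, scalars `c cB`, ANY
border `B` without ff block): the leg-and-bond symmetrised ff cell zero mode of the level-`0` E-frame forcing `b̃_0 = c • mmRead Lc (K3OfK X̃♮_0 Lc S̃♮_0 M̃_0 W̃_0) + cB • B` is an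
antisymmetric-pair form in road-P2 F9's spelling — witness `T = 2·C₀·P`, `P(ab;ce) = [a=c][b=e] − [a=e][b=c]`. -/
theorem pairFormLS_forcing_level0 (hLc : 1 ≤ Lc) (hr : r ∈ box (d + 1) Lc) (sf sm cE cVH cΛ : ℝ)
    {B : Tab d} (hBff : ∀ κ u κ' u' x z (α β : Fin (d + 1)), B κ u κ' u' x z (Sum.inl α) (Sum.inl β) = 0) (c cB : ℝ) :
    ∃ T : Fin (d + 1) → Fin (d + 1) → Fin (d + 1) → Fin (d + 1) → ℝ,
      (∀ a b c e : Fin (d + 1), T b a c e = -T a b c e) ∧ (∀ a b c e : Fin (d + 1), T a b e c = -T a b c e) ∧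
      ∀ κ κ' κ₁ κ₂ : Fin (d + 1),
        (zmode Lc (fun κ u κ' u' => c • mmRead Lc (K3OfK (unitK sf sm (coDressKBmAt (toSite r) Lc (KInvStep (d := d) Lc 0))) Lc
            (unitS sf sm (SpureRecAt d Lc (toSite r) cE cVH cΛ 0)) (unitM sf sm (M1At d Lc (toSite r) cΛ 0))
            (W2SymOfK (unitK sf sm (coDressKBmAt (toSite r) Lc (KInvStep (d := d) Lc 0))) Lc (unitS sf sm (SpureRecAt d Lc (toSite r) cE cVH cΛ 0))
              (unitM sf sm (M1At d Lc (toSite r) cΛ 0)) 0 (unitM₂ sf sm (M2Of d Lc (mixFFAt (toSite r) Lc) 0))) κ u κ' u')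
            + cB • B κ u κ' u') κ κ' (Sum.inl κ₁) (Sum.inl κ₂)
        + zmode Lc (fun κ u κ' u' => c • mmRead Lc (K3OfK (unitK sf sm (coDressKBmAt (toSite r) Lc (KInvStep (d := d) Lc 0))) Lc
            (unitS sf sm (SpureRecAt d Lc (toSite r) cE cVH cΛ 0)) (unitM sf sm (M1At d Lc (toSite r) cΛ 0))
            (W2SymOfK (unitK sf sm (coDressKBmAt (toSite r) Lc (KInvStep (d := d) Lc 0))) Lc (unitS sf sm (SpureRecAt d Lc (toSite r) cE cVH cΛ 0))
              (unitM sf sm (M1At d Lc (toSite r) cΛ 0)) 0 (unitM₂ sf sm (M2Of d Lc (mixFFAt (toSite r) Lc) 0))) κ u κ' u')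
            + cB • B κ u κ' u') κ' κ (Sum.inl κ₁) (Sum.inl κ₂)
        + (zmode Lc (fun κ u κ' u' => c • mmRead Lc (K3OfK (unitK sf sm (coDressKBmAt (toSite r) Lc (KInvStep (d := d) Lc 0))) Lc
            (unitS sf sm (SpureRecAt d Lc (toSite r) cE cVH cΛ 0)) (unitM sf sm (M1At d Lc (toSite r) cΛ 0))
            (W2SymOfK (unitK sf sm (coDressKBmAt (toSite r) Lc (KInvStep (d := d) Lc 0))) Lc (unitS sf sm (SpureRecAt d Lc (toSite r) cE cVH cΛ 0))
              (unitM sf sm (M1At d Lc (toSite r) cΛ 0)) 0 (unitM₂ sf sm (M2Of d Lc (mixFFAt (toSite r) Lc) 0))) κ u κ' u')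
            + cB • B κ u κ' u') κ κ' (Sum.inl κ₂) (Sum.inl κ₁)
        + zmode Lc (fun κ u κ' u' => c • mmRead Lc (K3OfK (unitK sf sm (coDressKBmAt (toSite r) Lc (KInvStep (d := d) Lc 0))) Lc
            (unitS sf sm (SpureRecAt d Lc (toSite r) cE cVH cΛ 0)) (unitM sf sm (M1At d Lc (toSite r) cΛ 0))
            (W2SymOfK (unitK sf sm (coDressKBmAt (toSite r) Lc (KInvStep (d := d) Lc 0))) Lc (unitS sf sm (SpureRecAt d Lc (toSite r) cE cVH cΛ 0))
              (unitM sf sm (M1At d Lc (toSite r) cΛ 0)) 0 (unitM₂ sf sm (M2Of d Lc (mixFFAt (toSite r) Lc) 0))) κ u κ' u')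
            + cB • B κ u κ' u') κ' κ (Sum.inl κ₂) (Sum.inl κ₁)))
          = T κ κ₁ κ' κ₂ + T κ' κ₁ κ κ₂ + (T κ κ₂ κ' κ₁ + T κ' κ₂ κ κ₁) := by
  refine ⟨fun a b c' e =>
      2 * ((c * (-((sf * sm * ((((Lc ^ (0 + 1) : ℕ) : ℝ)) ^ (d + 1 + 1))⁻¹) * (sf * sm * ((((Lc ^ (0 + 1) : ℕ) : ℝ)) ^ (d + 1 + 1))⁻¹)) * ((Lc : ℝ) * (Lc : ℝ))) *
        (-(((((Lc : ℝ) * (sm * sf)) * ((((Lc ^ (0 + 1) : ℕ) : ℝ)) ^ (d + 1 + 1))⁻¹) * ((sf * sm)⁻¹ * (sf⁻¹ * sf⁻¹) * cE))) ^ 2 * (sf * sf) *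
          ((1 / 2 : ℝ) * (Lc : ℝ) ^ (d - 1) * ((Lc : ℝ) ^ (d + 1) - (Lc : ℝ) ^ (d - 1))))) *
        ((if a = c' then (1 : ℝ) else 0) * (if b = e then (1 : ℝ) else 0) - (if a = e then (1 : ℝ) else 0) * (if b = c' then (1 : ℝ) else 0))),
    fun a b c' e => by ring, fun a b c' e => by ring, fun κ κ' κ₁ κ₂ => ?_⟩
  exact pairFormLS_of_pairForm
    (A := fun κ κ' κ₁ κ₂ => zmode Lc (fun κ u κ' u' => c • mmRead Lc (K3OfK (unitK sf sm (coDressKBmAt (toSite r) Lc (KInvStep (d := d) Lc 0))) Lc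
            (unitS sf sm (SpureRecAt d Lc (toSite r) cE cVH cΛ 0)) (unitM sf sm (M1At d Lc (toSite r) cΛ 0))
            (W2SymOfK (unitK sf sm (coDressKBmAt (toSite r) Lc (KInvStep (d := d) Lc 0))) Lc (unitS sf sm (SpureRecAt d Lc (toSite r) cE cVH cΛ 0))
              (unitM sf sm (M1At d Lc (toSite r) cΛ 0)) 0 (unitM₂ sf sm (M2Of d Lc (mixFFAt (toSite r) Lc) 0))) κ u κ' u')
            + cB • B κ u κ' u') κ κ' (Sum.inl κ₁) (Sum.inl κ₂))
    (P := fun a b c' e =>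
      (c * (-((sf * sm * ((((Lc ^ (0 + 1) : ℕ) : ℝ)) ^ (d + 1 + 1))⁻¹) * (sf * sm * ((((Lc ^ (0 + 1) : ℕ) : ℝ)) ^ (d + 1 + 1))⁻¹)) * ((Lc : ℝ) * (Lc : ℝ))) *
        (-(((((Lc : ℝ) * (sm * sf)) * ((((Lc ^ (0 + 1) : ℕ) : ℝ)) ^ (d + 1 + 1))⁻¹) * ((sf * sm)⁻¹ * (sf⁻¹ * sf⁻¹) * cE))) ^ 2 * (sf * sf) *
          ((1 / 2 : ℝ) * (Lc : ℝ) ^ (d - 1) * ((Lc : ℝ) ^ (d + 1) - (Lc : ℝ) ^ (d - 1))))) *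
        ((if a = c' then (1 : ℝ) else 0) * (if b = e then (1 : ℝ) else 0) - (if a = e then (1 : ℝ) else 0) * (if b = c' then (1 : ℝ) else 0)))
    (fun κ κ' κ₁ κ₂ => zmode_forcing_level0_eq_pairForm hLc hr sf sm cE cVH cΛ hBff c cB κ κ' κ₁ κ₂) κ κ' κ₁ κ₂

/-! ## §3 The same at `d = 3` in road-P2's letters VERBATIM — `CombChargeTowerClosure`'s `hB0` at `i = 0` -/

/-- NOT IN PRINT; OUR BOOKKEEPING.  **`hB0` AT `i = 0`, road-P2's LITERAL** (`d = 3`; units `sfStep Lc 0`, `smStep 3 Lc 0`; scale `cE₂ * Lc^(2*(3+1))`; an1's tables; in-block root,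
`1 ≤ Lc`; all colour constants `cE cVH cΛ cE₂ cB`; ANY border `vh₂S` without ff block) — the body of `CombChargeTowerClosure.pairFormLS_member_and_faceReads_of_forcingPairForms`'s binder
`hB0` with `i := 0`, nothing renamed (§2 instantiated). -/
theorem pairFormLS_forcing_level0_lit {r : Fin (3 + 1) → ℕ} (hLc : 1 ≤ Lc) (hr : r ∈ box (3 + 1) Lc) (cE cVH cΛ cE₂ cB : ℝ)
    {vh₂S : Tab 3} (hBff : ∀ κ u κ' u' x z (α β : Fin (3 + 1)), vh₂S κ u κ' u' x z (Sum.inl α) (Sum.inl β) = 0) :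
    ∃ T : Fin (3 + 1) → Fin (3 + 1) → Fin (3 + 1) → Fin (3 + 1) → ℝ,
      (∀ a b c e : Fin (3 + 1), T b a c e = -T a b c e) ∧ (∀ a b c e : Fin (3 + 1), T a b e c = -T a b c e) ∧
      ∀ κ κ' κ₁ κ₂ : Fin (3 + 1),
        (zmode Lc ((fun κ u κ' u' => (cE₂ * (Lc : ℝ) ^ (2 * (3 + 1))) • mmRead Lc (K3OfK (unitK (sfStep Lc 0) (smStep 3 Lc 0) (coDressKBmAt (toSite r) Lc (KInvStep (d := 3) Lc 0))) Lc (unitS (sfStep Lc 0) (smStep 3 Lc 0) (SpureRecAt 3 Lc (toSite r) cE cVH cΛ 0)) (unitM (sfStep Lc 0) (smStep 3 Lc 0) (M1At 3 Lc (toSite r) cΛ 0)) (W2SymOfK (unitK (sfStep Lc 0) (smStep 3 Lc 0) (coDressKBmAt (toSite r) Lc (KInvStep (d := 3) Lc 0))) Lc (unitS (sfStep Lc 0) (smStep 3 Lc 0) (SpureRecAt 3 Lc (toSite r) cE cVH cΛ 0)) (unitM (sfStep Lc 0) (smStep 3 Lc 0) (M1At 3 Lc (toSite r) cΛ 0)) 0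 (unitM₂ (sfStep Lc 0) (smStep 3 Lc 0) (M2Of 3 Lc (mixFFAt (toSite r) Lc) 0))) κ u κ' u') + cB • vh₂S κ u κ' u')) κ κ' (Sum.inl κ₁) (Sum.inl κ₂)
      + zmode Lc ((fun κ u κ' u' => (cE₂ * (Lc : ℝ) ^ (2 * (3 + 1))) • mmRead Lc (K3OfK (unitK (sfStep Lc 0) (smStep 3 Lc 0) (coDressKBmAt (toSite r) Lc (KInvStep (d := 3) Lc 0))) Lc (unitS (sfStep Lc 0) (smStep 3 Lc 0) (SpureRecAt 3 Lc (toSite r) cE cVH cΛ 0)) (unitM (sfStep Lc 0) (smStep 3 Lc 0) (M1At 3 Lc (toSite r) cΛ 0)) (W2SymOfK (unitK (sfStep Lc 0) (smStep 3 Lc 0) (coDressKBmAt (toSite r) Lc (KInvStep (d := 3) Lc 0))) Lc (unitS (sfStep Lc 0) (smStep 3 Lc 0) (SpureRecAt 3 Lc (toSite r) cE cVH cΛ 0)) (unitM (sfStep Lc 0) (smStep 3 Lc 0) (M1At 3 Lc (toSite r) cΛ 0)) 0 (unitM₂ (sfStep Lc 0) (smStep 3 Lc 0) (M2Of 3 Lc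 (mixFFAt (toSite r) Lc) 0))) κ u κ' u') + cB • vh₂S κ u κ' u')) κ' κ (Sum.inl κ₁) (Sum.inl κ₂)
      + (zmode Lc ((fun κ u κ' u' => (cE₂ * (Lc : ℝ) ^ (2 * (3 + 1))) • mmRead Lc (K3OfK (unitK (sfStep Lc 0) (smStep 3 Lc 0) (coDressKBmAt (toSite r) Lc (KInvStep (d := 3) Lc 0))) Lc (unitS (sfStep Lc 0) (smStep 3 Lc 0) (SpureRecAt 3 Lc (toSite r) cE cVH cΛ 0)) (unitM (sfStep Lc 0) (smStep 3 Lc 0) (M1At 3 Lc (toSite r) cΛ 0)) (W2SymOfK (unitK (sfStep Lc 0) (smStep 3 Lc 0) (coDressKBmAt (toSite r) Lc (KInvStep (d := 3) Lc 0))) Lc (unitS (sfStep Lc 0) (smStep 3 Lc 0) (SpureRecAt 3 Lc (toSite r) cE cVH cΛ 0)) (unitM (sfStep Lc 0) (smStep 3 Lc 0) (M1At 3 Lc (toSite r) cΛ 0)) 0 (unitM₂ (sfStep Lc 0) (smStep 3 Lc 0) (M2Of 3 Lc (mixFFAt (toSite r) Lc) 0))) κ u κ' u') + cB • vh₂S κ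 u κ' u')) κ κ' (Sum.inl κ₂) (Sum.inl κ₁)
      + zmode Lc ((fun κ u κ' u' => (cE₂ * (Lc : ℝ) ^ (2 * (3 + 1))) • mmRead Lc (K3OfK (unitK (sfStep Lc 0) (smStep 3 Lc 0) (coDressKBmAt (toSite r) Lc (KInvStep (d := 3) Lc 0))) Lc (unitS (sfStep Lc 0) (smStep 3 Lc 0) (SpureRecAt 3 Lc (toSite r) cE cVH cΛ 0)) (unitM (sfStep Lc 0) (smStep 3 Lc 0) (M1At 3 Lc (toSite r) cΛ 0)) (W2SymOfK (unitK (sfStep Lc 0) (smStep 3 Lc 0) (coDressKBmAt (toSite r) Lc (KInvStep (d := 3) Lc 0))) Lc (unitS (sfStep Lc 0) (smStep 3 Lc 0) (SpureRecAt 3 Lc (toSite r) cE cVH cΛ 0)) (unitM (sfStep Lc 0) (smStep 3 Lc 0) (M1At 3 Lc (toSite r) cΛ 0)) 0 (unitM₂ (sfStep Lc 0) (smStep 3 Lc 0) (M2Of 3 Lc (mixFFAt (toSite r) Lc) 0))) κ u κ' u') + cB • vh₂S κ u κ' u')) κ' κ (Sum.inl κ₂) (Sum.inl κ₁)))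
          = T κ κ₁ κ' κ₂ + T κ' κ₁ κ κ₂ + (T κ κ₂ κ' κ₁ + T κ' κ₂ κ κ₁) :=
  pairFormLS_forcing_level0 (d := 3) hLc hr (sfStep Lc 0) (smStep 3 Lc 0) cE cVH cΛ hBff (cE₂ * (Lc : ℝ) ^ (2 * (3 + 1))) cB

/-! ## §4 The crossed cell VALUE of the level-`0` forcing (row T6-VAL's first summand at `l = 0`, leaf-03 g71 `CrossedLedgerForcing`'s currency) -/

/-- NOT IN PRINT; OUR BOOKKEEPING.  **THE CROSSED ORBIT SUM OF THE LEVEL-`0` FORCING's ff CELL ZERO MODE, CLOSED FORM** (generic `d`; hypotheses of §1; `a ≠ b`):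
`X(zmode_Lc b̃_0)(a,b) := Z abab + Z baab + (Z abba + Z baba) = −4·C₀` — read off §1 (`P(aa;bb) = P(bb;aa) = 0`, `P(ba;ab) = P(ab;ba) = −1`).  The VALUE enters
leaf-03 g71's unrolled crossed ledger (`CrossedLedgerForcing.memberCrossedRatio_iff_forcingLedger_pin_closed`, level `l = 0`, first bracket) — nothing of that ledger is asserted here. -/
theorem crossed_zmode_forcing_level0 (hLc : 1 ≤ Lc) (hr : r ∈ box (d + 1) Lc) (sf sm cE cVH cΛ : ℝ)
    {B : Tab d} (hBff : ∀ κ u κ' u' x z (α β : Fin (d + 1)), B κ u κ' u' x z (Sum.inl α) (Sum.inl β) = 0) (c cB : ℝ)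
    {a b : Fin (d + 1)} (hab : a ≠ b) :
    zmode Lc (fun κ u κ' u' => c • mmRead Lc (K3OfK (unitK sf sm (coDressKBmAt (toSite r) Lc (KInvStep (d := d) Lc 0))) Lc
            (unitS sf sm (SpureRecAt d Lc (toSite r) cE cVH cΛ 0)) (unitM sf sm (M1At d Lc (toSite r) cΛ 0))
            (W2SymOfK (unitK sf sm (coDressKBmAt (toSite r) Lc (KInvStep (d := d) Lc 0))) Lc (unitS sf sm (SpureRecAt d Lc (toSite r) cE cVH cΛ 0))
              (unitM sf sm (M1At d Lc (toSite r) cΛ 0)) 0 (unitM₂ sf sm (M2Of d Lc (mixFFAt (toSite r) Lc) 0))) κ u κ' u')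
            + cB • B κ u κ' u') a b (Sum.inl a) (Sum.inl b)
      + zmode Lc (fun κ u κ' u' => c • mmRead Lc (K3OfK (unitK sf sm (coDressKBmAt (toSite r) Lc (KInvStep (d := d) Lc 0))) Lc
            (unitS sf sm (SpureRecAt d Lc (toSite r) cE cVH cΛ 0)) (unitM sf sm (M1At d Lc (toSite r) cΛ 0))
            (W2SymOfK (unitK sf sm (coDressKBmAt (toSite r) Lc (KInvStep (d := d) Lc 0))) Lc (unitS sf sm (SpureRecAt d Lc (toSite r) cE cVH cΛ 0))
              (unitM sf sm (M1At d Lc (toSite r) cΛ 0)) 0 (unitM₂ sf sm (M2Of d Lc (mixFFAt (toSite r) Lc) 0))) κ u κ' u')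
            + cB • B κ u κ' u') b a (Sum.inl a) (Sum.inl b)
      + (zmode Lc (fun κ u κ' u' => c • mmRead Lc (K3OfK (unitK sf sm (coDressKBmAt (toSite r) Lc (KInvStep (d := d) Lc 0))) Lc
            (unitS sf sm (SpureRecAt d Lc (toSite r) cE cVH cΛ 0)) (unitM sf sm (M1At d Lc (toSite r) cΛ 0))
            (W2SymOfK (unitK sf sm (coDressKBmAt (toSite r) Lc (KInvStep (d := d) Lc 0))) Lc (unitS sf sm (SpureRecAt d Lc (toSite r) cE cVH cΛ 0))
              (unitM sf sm (M1At d Lc (toSite r) cΛ 0)) 0 (unitM₂ sf sm (M2Of d Lc (mixFFAt (toSite r) Lc) 0))) κ u κ' u')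
            + cB • B κ u κ' u') a b (Sum.inl b) (Sum.inl a)
      + zmode Lc (fun κ u κ' u' => c • mmRead Lc (K3OfK (unitK sf sm (coDressKBmAt (toSite r) Lc (KInvStep (d := d) Lc 0))) Lc
            (unitS sf sm (SpureRecAt d Lc (toSite r) cE cVH cΛ 0)) (unitM sf sm (M1At d Lc (toSite r) cΛ 0))
            (W2SymOfK (unitK sf sm (coDressKBmAt (toSite r) Lc (KInvStep (d := d) Lc 0))) Lc (unitS sf sm (SpureRecAt d Lc (toSite r) cE cVH cΛ 0))
              (unitM sf sm (M1At d Lc (toSite r) cΛ 0)) 0 (unitM₂ sf sm (M2Of d Lc (mixFFAt (toSite r) Lc) 0))) κ u κ' u')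
            + cB • B κ u κ' u') b a (Sum.inl b) (Sum.inl a))
      = -4 * (c * (-((sf * sm * ((((Lc ^ (0 + 1) : ℕ) : ℝ)) ^ (d + 1 + 1))⁻¹) * (sf * sm * ((((Lc ^ (0 + 1) : ℕ) : ℝ)) ^ (d + 1 + 1))⁻¹)) * ((Lc : ℝ) * (Lc : ℝ))) *
        (-(((((Lc : ℝ) * (sm * sf)) * ((((Lc ^ (0 + 1) : ℕ) : ℝ)) ^ (d + 1 + 1))⁻¹) * ((sf * sm)⁻¹ * (sf⁻¹ * sf⁻¹) * cE))) ^ 2 * (sf * sf) *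
          ((1 / 2 : ℝ) * (Lc : ℝ) ^ (d - 1) * ((Lc : ℝ) ^ (d + 1) - (Lc : ℝ) ^ (d - 1))))) := by
  have hba : b ≠ a := fun h => hab h.symm
  rw [zmode_forcing_level0_eq_pairForm hLc hr sf sm cE cVH cΛ hBff c cB,
    zmode_forcing_level0_eq_pairForm hLc hr sf sm cE cVH cΛ hBff c cB,
    zmode_forcing_level0_eq_pairForm hLc hr sf sm cE cVH cΛ hBff c cB,
    zmode_forcing_level0_eq_pairForm hLc hr sf sm cE cVH cΛ hBff c cB]
  rw [if_neg hab, if_neg hba, if_pos (rfl : a = a), if_pos (rfl : b = b)]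
  ring

/-- NOT IN PRINT; OUR BOOKKEEPING.  **THE SAME NUMBER AT THE LITERAL's PINS** (`d = 3`, road-P2's letters: units `sfStep Lc 0 = Lc^0`, `smStep 3 Lc 0 = Lc^0`, scale
`cE₂ * Lc^(2*(3+1))`, an1's tables, border `vh₂S` without ff block; the END probe's pins `cE = Lc^(3+1)`, `cE₂ = Lc^(2*(3+1))`; `cVH cΛ cB` free; `a ≠ b`):
`X(zmode_Lc b̃_0)(a,b) = −2·Lc¹²·(Lc² − 1)`. -/
theorem crossed_zmode_forcing_level0_pin {r : Fin (3 + 1) → ℕ} (hLc : 1 ≤ Lc) (hr : r ∈ box (3 + 1) Lc) {cE cE₂ : ℝ} (cVH cΛ cB : ℝ)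
    (hcE : cE = (Lc : ℝ) ^ (3 + 1)) (hcE₂ : cE₂ = (Lc : ℝ) ^ (2 * (3 + 1)))
    {vh₂S : Tab 3} (hBff : ∀ κ u κ' u' x z (α β : Fin (3 + 1)), vh₂S κ u κ' u' x z (Sum.inl α) (Sum.inl β) = 0)
    {a b : Fin (3 + 1)} (hab : a ≠ b) :
    zmode Lc ((fun κ u κ' u' => (cE₂ * (Lc : ℝ) ^ (2 * (3 + 1))) • mmRead Lc (K3OfK (unitK (sfStep Lc 0) (smStep 3 Lc 0) (coDressKBmAt (toSite r) Lc (KInvStep (d := 3) Lc 0))) Lc (unitS (sfStep Lc 0) (smStep 3 Lc 0) (SpureRecAt 3 Lc (toSite r) cE cVH cΛ 0)) (unitM (sfStep Lc 0) (smStep 3 Lc 0) (M1At 3 Lc (toSite r) cΛ 0)) (W2SymOfK (unitK (sfStep Lc 0) (smStep 3 Lc 0) (coDressKBmAt (toSite r) Lc (KInvStep (d := 3) Lc 0))) Lc (unitS (sfStep Lc 0) (smStep 3 Lc 0) (SpureRecAt 3 Lc (toSite r) cE cVH cΛ 0)) (unitM (sfStep Lc 0) (smStep 3 Lc 0) (M1At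 3 Lc (toSite r) cΛ 0)) 0 (unitM₂ (sfStep Lc 0) (smStep 3 Lc 0) (M2Of 3 Lc (mixFFAt (toSite r) Lc) 0))) κ u κ' u') + cB • vh₂S κ u κ' u')) a b (Sum.inl a) (Sum.inl b)
      + zmode Lc ((fun κ u κ' u' => (cE₂ * (Lc : ℝ) ^ (2 * (3 + 1))) • mmRead Lc (K3OfK (unitK (sfStep Lc 0) (smStep 3 Lc 0) (coDressKBmAt (toSite r) Lc (KInvStep (d := 3) Lc 0))) Lc (unitS (sfStep Lc 0) (smStep 3 Lc 0) (SpureRecAt 3 Lc (toSite r) cE cVH cΛ 0)) (unitM (sfStep Lc 0) (smStep 3 Lc 0) (M1At 3 Lc (toSite r) cΛ 0)) (W2SymOfK (unitK (sfStep Lc 0) (smStep 3 Lc 0) (coDressKBmAt (toSite r) Lc (KInvStep (d := 3) Lc 0))) Lc (unitS (sfStep Lc 0) (smStep 3 Lc 0) (SpureRecAt 3 Lc (toSite r) cE cVH cΛ 0)) (unitM (sfStep Lc 0) (smStep 3 Lc 0) (M1At 3 Lc (toSite r) cΛ 0)) 0 (unitM₂ (sfStep Lc 0) (smStep 3 Lc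 0) (M2Of 3 Lc (mixFFAt (toSite r) Lc) 0))) κ u κ' u') + cB • vh₂S κ u κ' u')) b a (Sum.inl a) (Sum.inl b)
      + (zmode Lc ((fun κ u κ' u' => (cE₂ * (Lc : ℝ) ^ (2 * (3 + 1))) • mmRead Lc (K3OfK (unitK (sfStep Lc 0) (smStep 3 Lc 0) (coDressKBmAt (toSite r) Lc (KInvStep (d := 3) Lc 0))) Lc (unitS (sfStep Lc 0) (smStep 3 Lc 0) (SpureRecAt 3 Lc (toSite r) cE cVH cΛ 0)) (unitM (sfStep Lc 0) (smStep 3 Lc 0) (M1At 3 Lc (toSite r) cΛ 0)) (W2SymOfK (unitK (sfStep Lc 0) (smStep 3 Lc 0) (coDressKBmAt (toSite r) Lc (KInvStep (d := 3) Lc 0))) Lc (unitS (sfStep Lc 0) (smStep 3 Lc 0) (SpureRecAt 3 Lc (toSite r) cE cVH cΛ 0)) (unitM (sfStep Lc 0) (smStep 3 Lc 0) (M1At 3 Lc (toSite r) cΛ 0)) 0 (unitM₂ (sfStep Lc 0) (smStep 3 Lc 0) (M2Of 3 Lc (mixFFAt (toSite r) Lc) 0))) κ u κ' u') + cB • vh₂S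 κ u κ' u')) a b (Sum.inl b) (Sum.inl a)
      + zmode Lc ((fun κ u κ' u' => (cE₂ * (Lc : ℝ) ^ (2 * (3 + 1))) • mmRead Lc (K3OfK (unitK (sfStep Lc 0) (smStep 3 Lc 0) (coDressKBmAt (toSite r) Lc (KInvStep (d := 3) Lc 0))) Lc (unitS (sfStep Lc 0) (smStep 3 Lc 0) (SpureRecAt 3 Lc (toSite r) cE cVH cΛ 0)) (unitM (sfStep Lc 0) (smStep 3 Lc 0) (M1At 3 Lc (toSite r) cΛ 0)) (W2SymOfK (unitK (sfStep Lc 0) (smStep 3 Lc 0) (coDressKBmAt (toSite r) Lc (KInvStep (d := 3) Lc 0))) Lc (unitS (sfStep Lc 0) (smStep 3 Lc 0) (SpureRecAt 3 Lc (toSite r) cE cVH cΛ 0)) (unitM (sfStep Lc 0) (smStep 3 Lc 0) (M1At 3 Lc (toSite r) cΛ 0)) 0 (unitM₂ (sfStep Lc 0) (smStep 3 Lc 0) (M2Of 3 Lc (mixFFAt (toSite r) Lc) 0))) κ u κ' u') + cB • vh₂S κ u κ' u')) b a (Sum.inl b) (Sum.inl a))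
      = -2 * (Lc : ℝ) ^ 12 * ((Lc : ℝ) ^ 2 - 1) := by
  have hL : (Lc : ℝ) ≠ 0 := Nat.cast_ne_zero.mpr (NeZero.ne Lc)
  rw [crossed_zmode_forcing_level0 (d := 3) hLc hr (sfStep Lc 0) (smStep 3 Lc 0) cE cVH cΛ hBff (cE₂ * (Lc : ℝ) ^ (2 * (3 + 1))) cB hab]
  subst hcE hcE₂
  simp only [sfStep, smStep, pow_zero, zero_mul, Nat.cast_pow]
  field_simp
  ring

end Summit.QuantumFields.BalabanUV.Beta.GAN24.ForcingCellPairFormLevelZero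

end
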